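import Summits.QuantumFields.GaugeBoot.Rows.GLYZc1D3BindB2
import HarnessLib

/-!
# Gauge-boot: generic torus-binding lemma for the glyz-c1-rp-3D certificate replays (any coupling)

Cell `pub-gaugeboot` (HOME `run/shared/lean/pub/pub-gaugeboot/`), seat lean1. `GLYZc1D3BindB2` (row C5) proved the
bridge from the kernel data check `rowOK` to lean3's `heq` hypothesis at `β_std = 2`; this file states it for an arbitrary
rational coupling `q`, so that each further row `C3…C14` needs only its own `decide`d data check against lean3's
`N1c1D3b<β>Rows` and the two certificate theorems.

HONEST FRAMING (page 1 of every file of this cell): certified bounds on lattice expectations at STATED coupling,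
gauge group, dimension and torus size; NOT a mass gap, NOT a continuum limit, NOT a string tension, NOT large `N`.
The venture is explicitly NOT Yang–Mills-summit-bearing (barriers `FixedCouplingUltralocality`,
`PerturbativeInvisibility`).
-/

noncomputable section

open Literature.MathematicalPhysics.QuantumFieldTheory
open Summit.QuantumFields.GaugeBoot.Certificates Summit.QuantumFields.GaugeBoot.Certificates.Sparse

namespace Summit.QuantumFields.GaugeBoot

namespace GLYZc1D3

variable (L : ℕ) [NeZero L]

/-- **From the data check to lean3's `heq`, any rational coupling `q`**: a family of sparse rows passing `rowOK q` row by
row (right-hand sides `0`, distinct in-range columns, labelled row = a permutation of the `E` row at `q`) holds for the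
torus expectations `y v = ⟨W_0(label v)⟩_{β_std = q}` on every torus `L ≥ 4` (via `E_holds`). -/
theorem heq_of_rowsOK_at (q : ℚ) (rows : ℕ → ℚ × List (ℕ × ℚ))
    (hok : ∀ e < 103, rowOK q (rows e) (E.getD e []) = true) (h4 : 4 ≤ L) (e : Fin 103) :
    ∑ v : Fin 435, (sget (rows e.val).2 v.val : ℝ) * y (q : ℝ) L v = ((rows e.val).1 : ℝ) := by
  have hok' := hok e.val e.isLt
  simp only [rowOK, Bool.and_eq_true, decide_eq_true_eq, List.all_eq_true] at hok'
  obtain ⟨⟨⟨hrhs, hnd⟩, hlt⟩, hperm⟩ := hok'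
  rw [hrhs, Rat.cast_zero]
  have hy : ∀ v : Fin 435, y (q : ℝ) L v = Rung0D3.W (q : ℝ) L (labelN v.val) := fun v => by
    simp [y, labelN, v.isLt]
  simp only [hy]
  rw [sum_sget_mul (fun k => Rung0D3.W (q : ℝ) L (labelN k)) _ hnd fun p hp => hlt p hp]
  have hmap : ((rows e.val).2.map fun p => (p.2 : ℝ) * Rung0D3.W (q : ℝ) L (labelN p.1)) =
      (rwPairs (rows e.val).2).map fun r => (r.2 : ℝ) * Rung0D3.W (q : ℝ) L r.1 := by
    simp [rwPairs, List.map_map, Function.comp_def]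
  rw [hmap, (hperm.map _).sum_eq, sum_ePairs]
  exact E_holds (q : ℝ) L h4 e.val (by rw [length_E]; exact e.isLt)

end GLYZc1D3

end Summit.QuantumFields.GaugeBoot

end
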